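import Mathlib
import HarnessLib
import Literature.MathematicalPhysics.QuantumFieldTheory.YangMillsOS
import Literature.MathematicalPhysics.QuantumFieldTheory.WilsonEnergyConvexity

/-!
# Crux `FemtoCurvatureTwoPoint` (stmt-QuantumFields-9363, route `LangevinControlUV`):
# stub VAR-even — plaquette variance on every even torus from the chessboard estimate and
# `Z`-doubling

Helper for the line `generic-step-gamma-encoding` (`--supports stmt-QuantumFields-9363`), closing
the registered stub `stub_varianceEven_of_chessboard_doubling` verbatim. With
`P_x(U) = N − Re tr ρ(U_{x;01}) ∈ [0, 2N]` the `01`-plaquette field on the torus `(ℤ/L)⁴`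
(`L` even, `k = L⁴` sites), `S = wilsonAction ρ ≥ ∑ₓ P_x` the Wilson action and `Z(β)` the
partition function (tree objects of `ConstructiveQFTWave0`), the two hypotheses of the stub are

* CHESS: `⟨f(P_0)⟩_β ≤ ⟨∏ₓ f(P_x)⟩_β^{1/k}` for bounded measurable `f ≥ 0` (chessboard estimate
  from reflection positivity on even tori), used with `f = min(t², 4N²)`, i.e. `f(P_x) = P_x²`;
* DBL: `Z(β/2) ≤ e^{A k} Z(β)` for `β ≥ B₂(L)` (partition-function doubling),

and the conclusion is `β² · |⟨P_0²⟩ − ⟨P_0⟩²| ≤ C` with ONE constant `C = 16 e^{A-2}` for all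
even `L` and all `β ≥ max(B₂(L), 1)`. The proof:
`0 ≤ Var P_0 ≤ ⟨P_0²⟩ ≤ ⟨∏ₓ P_x²⟩^{1/k}` (variance of a probability measure, CHESS); pointwise
AM–GM `∏ₓ P_x² ≤ (S/k)^{2k}` and the moment bound `(s/k)^{2k} ≤ (4/(eβ))^{2k} e^{βs/2}`
(`y ≤ e^{y−1}`, `y = βs/(4k)`); `⟨e^{βS/2}⟩_β = Z(β/2)/Z(β) ≤ e^{Ak}` (DBL); taking the `k`-th
root, `β² ⟨P_0²⟩ ≤ 16 e^{A} / e²`.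

The helper lemmas (sub-namespace `VarianceEven`) are adapted from the dyadic twin
`LangevinControlUVFemtoCurvatureTwoPointStubVarianceOfChessboardDoubling` (namespace
`PlaquetteVariance`); they are repeated here as `private` lemmas, so that this file neither
depends on a freshly landed module nor duplicates public tree declarations. All folklore; proved
from Mathlib and the tree (`WilsonEnergyConvexity`, `ConstructiveQFTWave0Proofs`,
`LatticeGaugeProofs`, `UnitaryTrick`).
The unused hypothesis `IsCompactSimpleLieGroup G` of the stub is not needed for this step.
-/

noncomputable section

open scoped BigOperators Matrix
open MeasureTheory Filter Topology ProbabilityTheory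

namespace Summit.QuantumFields.YangMills.Theorems.FemtoCurvatureTwoPoint.VarianceEven
-- adapted from …Theorems.LangevinControlUVFemtoCurvatureTwoPointStubVarianceOfChessboardDoubling
open Literature.MathematicalPhysics.QuantumFieldTheory

/-! ### Two elementary real inequalities -/

/-- The moment bound `(s/k)^{2k} ≤ (4/(eβ))^{2k} · e^{βs/2}` for `s ≥ 0`, `β > 0`, `k ≥ 1`
(from `y ≤ e^{y-1}` with `y = βs/(4k)`, raised to the power `2k`). [folklore] -/
private theorem div_pow_le_mul_exp {s β : ℝ} (hs : 0 ≤ s) (hβ : 0 < β) {k : ℕ} (hk : 0 < k) :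
    (s / k) ^ (2 * k) ≤ (4 / (Real.exp 1 * β)) ^ (2 * k) * Real.exp (β / 2 * s) := by
  have hk' : (0 : ℝ) < k := Nat.cast_pos.2 hk
  set y : ℝ := β * s / (4 * k) with hy
  have hy0 : 0 ≤ y := by positivity
  have hyexp : y ≤ Real.exp (y - 1) := by linarith [Real.add_one_le_exp (y - 1)]
  have h1 : s / k = 4 / β * y := by rw [hy]; field_simp
  have h2 : y ^ (2 * k) ≤ Real.exp (y - 1) ^ (2 * k) := pow_le_pow_left₀ hy0 hyexp _
  have h3 : Real.exp (y - 1) ^ (2 * k) = Real.exp (-1) ^ (2 * k) * Real.exp (β / 2 * s) := by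
    rw [← Real.exp_nat_mul, ← Real.exp_nat_mul, ← Real.exp_add]
    congr 1
    rw [hy]
    push_cast
    field_simp
    ring
  have h4 : (4 / (Real.exp 1 * β)) ^ (2 * k) = (4 / β) ^ (2 * k) * Real.exp (-1) ^ (2 * k) := by
    rw [← mul_pow, Real.exp_neg]
    congr 1
    field_simp
  calc (s / k) ^ (2 * k) = (4 / β) ^ (2 * k) * y ^ (2 * k) := by rw [h1, mul_pow]
    _ ≤ (4 / β) ^ (2 * k) * Real.exp (y - 1) ^ (2 * k) :=
        mul_le_mul_of_nonneg_left h2 (pow_nonneg (by positivity) _)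
    _ = (4 / (Real.exp 1 * β)) ^ (2 * k) * Real.exp (β / 2 * s) := by rw [h3, h4, mul_assoc]

/-- AM–GM for a product of squares: `∏ᵢ zᵢ² ≤ ((∑ᵢ zᵢ)/k)^{2k}` for non-negative `zᵢ` indexed
by a finite type with `k ≥ 1` elements. [folklore] -/
private theorem prod_sq_le_pow {ι : Type*} [Fintype ι] [Nonempty ι] (z : ι → ℝ) (hz : ∀ i, 0 ≤ z i) :
    ∏ i, z i ^ 2 ≤ ((∑ i, z i) / Fintype.card ι) ^ (2 * Fintype.card ι) := by
  set k := Fintype.card ι with hk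
  have hk0 : k ≠ 0 := Fintype.card_ne_zero
  have hkpos : (0 : ℝ) < k := Nat.cast_pos.2 (Nat.pos_of_ne_zero hk0)
  have hsum : ∑ _i : ι, (1 : ℝ) = k := by
    rw [Finset.sum_const, Finset.card_univ, nsmul_eq_mul, mul_one]
  have h := Real.geom_mean_le_arith_mean Finset.univ (fun _ => (1 : ℝ)) z
    (fun _ _ => zero_le_one) (by rw [hsum]; exact hkpos) (fun i _ => hz i)
  simp only [Real.rpow_one, one_mul, hsum] at h
  have hprod : 0 ≤ ∏ i, z i := Finset.prod_nonneg fun i _ => hz i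
  have hg : 0 ≤ (∏ i, z i) ^ ((k : ℝ)⁻¹) := Real.rpow_nonneg hprod _
  calc ∏ i, z i ^ 2 = (∏ i, z i) ^ 2 := Finset.prod_pow _ _ _
    _ = (((∏ i, z i) ^ ((k : ℝ)⁻¹)) ^ k) ^ 2 := by rw [Real.rpow_inv_natCast_pow hprod hk0]
    _ = ((∏ i, z i) ^ ((k : ℝ)⁻¹)) ^ (2 * k) := by rw [← pow_mul, mul_comm]
    _ ≤ ((∑ i, z i) / k) ^ (2 * k) := pow_le_pow_left₀ hg h _

/-! ### The `01`-plaquette field and the Wilson action -/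

section Pointwise

variable {G : Type*} [Group G] {N : ℕ} (ρ : G →* Matrix (Fin N) (Fin N) ℂ)

/-- `∑ₓ (N − Re tr ρ(U_{x;01})) ≤ S(U)`: the `01`-plaquettes are among all plaquettes and every
term `N − Re tr ρ(U_p)` of the Wilson action is non-negative (`Re tr ρ ≤ N`). [folklore] -/
private theorem sum_plaq01_le_wilsonAction {L : ℕ} [NeZero L] (hρN : ∀ g, (ρ g).trace.re ≤ N)
    (U : GaugeConfig 4 L G) :
    ∑ x : Site 4 L, ((N : ℝ) - (ρ (plaquetteHolonomy U x 0 1)).trace.re) ≤ wilsonAction ρ U := by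
  have hterm : ∀ (x : Site 4 L) (q : {q : Fin 4 × Fin 4 // q.1 < q.2}), q ∈ Finset.univ →
      0 ≤ (N : ℝ) - (ρ (plaquetteHolonomy U x q.1.1 q.1.2)).trace.re :=
    fun x q _ => sub_nonneg.2 (hρN _)
  obtain ⟨c, hc1, hc2⟩ : ∃ c : {q : Fin 4 × Fin 4 // q.1 < q.2}, c.1.1 = 0 ∧ c.1.2 = 1 :=
    ⟨⟨((0 : Fin 4), (1 : Fin 4)), by decide⟩, rfl, rfl⟩
  have hx : ∀ x : Site 4 L, ((N : ℝ) - (ρ (plaquetteHolonomy U x 0 1)).trace.re) ≤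
      ∑ q : {q : Fin 4 × Fin 4 // q.1 < q.2},
        ((N : ℝ) - (ρ (plaquetteHolonomy U x q.1.1 q.1.2)).trace.re) := by
    intro x
    have h := Finset.single_le_sum (hterm x) (Finset.mem_univ c)
    rw [hc1, hc2] at h
    exact h
  calc ∑ x : Site 4 L, ((N : ℝ) - (ρ (plaquetteHolonomy U x 0 1)).trace.re)
      ≤ ∑ x : Site 4 L, ∑ q : {q : Fin 4 × Fin 4 // q.1 < q.2},
          ((N : ℝ) - (ρ (plaquetteHolonomy U x q.1.1 q.1.2)).trace.re) :=
        Finset.sum_le_sum fun x _ => hx x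
    _ = wilsonAction ρ U := by
        unfold wilsonAction
        rw [Fintype.sum_prod_type]

/-- The number of sites of the torus `(ℤ/L)⁴` is `L⁴`. [folklore] -/
private theorem card_site (L : ℕ) [NeZero L] : Fintype.card (Site 4 L) = L ^ 4 := by
  rw [Fintype.card_fun, ZMod.card, Fintype.card_fin]

/-- Pointwise bound on the product of the squared `01`-plaquette fields over all sites:
`∏ₓ P_x(U)² ≤ (4/(eβ))^{2L⁴} · e^{β S(U)/2}` (AM–GM, `∑ₓ P_x ≤ S`, and the moment bound
`(s/k)^{2k} ≤ (4/(eβ))^{2k} e^{βs/2}`). [folklore] -/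
private theorem prod_plaq_sq_le {L : ℕ} [NeZero L] (hρN : ∀ g, (ρ g).trace.re ≤ N) {β : ℝ}
    (hβ : 0 < β) (U : GaugeConfig 4 L G) :
    ∏ x : Site 4 L, ((N : ℝ) - (ρ (plaquetteHolonomy U x 0 1)).trace.re) ^ 2 ≤
      (4 / (Real.exp 1 * β)) ^ (2 * L ^ 4) * Real.exp (β / 2 * wilsonAction ρ U) := by
  have h0 : ∀ g, 0 ≤ (N : ℝ) - (ρ g).trace.re := fun g => sub_nonneg.2 (hρN g)
  have hS0 : 0 ≤ wilsonAction ρ U := Finset.sum_nonneg fun _ _ => h0 _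
  have hk : 0 < L ^ 4 := pow_pos (Nat.pos_of_ne_zero (NeZero.ne L)) 4
  have hsum0 : 0 ≤ ∑ x : Site 4 L, ((N : ℝ) - (ρ (plaquetteHolonomy U x 0 1)).trace.re) :=
    Finset.sum_nonneg fun _ _ => h0 _
  calc ∏ x : Site 4 L, ((N : ℝ) - (ρ (plaquetteHolonomy U x 0 1)).trace.re) ^ 2
      ≤ ((∑ x : Site 4 L, ((N : ℝ) - (ρ (plaquetteHolonomy U x 0 1)).trace.re)) /
          Fintype.card (Site 4 L)) ^ (2 * Fintype.card (Site 4 L)) :=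
        prod_sq_le_pow _ fun x => h0 _
    _ = ((∑ x : Site 4 L, ((N : ℝ) - (ρ (plaquetteHolonomy U x 0 1)).trace.re)) /
          ((L ^ 4 : ℕ) : ℝ)) ^ (2 * L ^ 4) := by rw [card_site]
    _ ≤ (wilsonAction ρ U / ((L ^ 4 : ℕ) : ℝ)) ^ (2 * L ^ 4) := by
        gcongr
        exact sum_plaq01_le_wilsonAction ρ hρN U
    _ ≤ (4 / (Real.exp 1 * β)) ^ (2 * L ^ 4) * Real.exp (β / 2 * wilsonAction ρ U) :=
        div_pow_le_mul_exp hS0 hβ hk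

end Pointwise

/-! ### Trace bounds -/

section Trace

variable {G : Type*} [Group G] [TopologicalSpace G] [IsTopologicalGroup G] [CompactSpace G]
  {N : ℕ} (ρ : G →* Matrix (Fin N) (Fin N) ℂ)

/-- `|Re tr ρ(g)| ≤ N` for a continuous `N`-dimensional representation of a compact group
(tree `UnitaryTrick.abs_re_trace_le_card`). [folklore] -/
private theorem abs_re_trace_le (hρ : Continuous ρ) (g : G) : |(ρ g).trace.re| ≤ N := by
  simpa using
    Literature.RepresentationTheory.CompactGroups.CompactGroup.abs_re_trace_le_card ρ hρ g

/-- `Re tr ρ(g) ≤ N` for a continuous `N`-dimensional representation of a compact group.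
[folklore] -/
private theorem re_trace_le (hρ : Continuous ρ) (g : G) : (ρ g).trace.re ≤ N :=
  (abs_le.1 (abs_re_trace_le ρ hρ g)).2

/-- `0 ≤ N − Re tr ρ(g) ≤ 2N`. [folklore] -/
private theorem plaqField_mem (hρ : Continuous ρ) (g : G) :
    0 ≤ (N : ℝ) - (ρ g).trace.re ∧ (N : ℝ) - (ρ g).trace.re ≤ 2 * N := by
  obtain ⟨h1, h2⟩ := abs_le.1 (abs_re_trace_le ρ hρ g)
  constructor <;> linarith

end Trace

/-! ### Wilson expectations -/

section Wilson

variable {G : Type*} [Group G] [TopologicalSpace G] [IsTopologicalGroup G] [CompactSpace G]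
  [MeasurableSpace G] [BorelSpace G] {N : ℕ} (ρ : G →* Matrix (Fin N) (Fin N) ℂ)

omit [CompactSpace G] in
/-- The `01`-plaquette field `U ↦ N − Re tr ρ(U_{x;01})` is measurable for the product
σ-algebra (continuous `ρ`; no countability assumption, via `WilsonRP.measurable_plaqRe`).
[folklore] -/
private theorem measurable_plaq01 {L : ℕ} (hρ : Continuous ρ) (x : Site 4 L) :
    Measurable fun U : GaugeConfig 4 L G => (N : ℝ) - (ρ (plaquetteHolonomy U x 0 1)).trace.re := by
  obtain ⟨c, hc1, hc2⟩ : ∃ c : {q : Fin 4 × Fin 4 // q.1 < q.2}, c.1.1 = 0 ∧ c.1.2 = 1 :=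
    ⟨⟨((0 : Fin 4), (1 : Fin 4)), by decide⟩, rfl, rfl⟩
  have h := WilsonRP.measurable_plaqRe (d := 4) (L := L) ρ hρ (x, c)
  unfold WilsonRP.plaqRe at h
  rw [hc1, hc2] at h
  exact measurable_const.sub h

/-- **`⟨e^{βS/2}⟩_β = Z(β/2) / Z(β)`** (both sides as product-Haar integrals,
`wilsonExpectation_eq_integral_div`, `partitionFunction_toReal_eq_integral`). [folklore] -/
private theorem wilsonExpectation_exp_half_mul {d L : ℕ} [NeZero L] (hρ : Continuous ρ) (β : ℝ) :
    wilsonExpectation ρ β (fun U : GaugeConfig d L G => Real.exp (β / 2 * wilsonAction ρ U)) =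
      (partitionFunction (d := d) (L := L) ρ (β / 2)).toReal /
        (partitionFunction (d := d) (L := L) ρ β).toReal := by
  rw [wilsonExpectation_eq_integral_div ρ hρ, partitionFunction_toReal_eq_integral ρ hρ,
    partitionFunction_toReal_eq_integral ρ hρ]
  congr 1
  refine integral_congr_ae (ae_of_all _ fun U => ?_)
  beta_reduce
  rw [← Real.exp_add]
  congr 1
  ring

/-- `0 < Z(β)` as a real number. [folklore] -/
private theorem partitionFunction_toReal_pos {d L : ℕ} [NeZero L] (hρ : Continuous ρ) (β : ℝ) :
    0 < (partitionFunction (d := d) (L := L) ρ β).toReal := by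
  rw [partitionFunction_toReal_eq_integral ρ hρ]
  exact integral_exp_neg_mul_wilsonAction_pos ρ hρ β

/-- Wilson expectations of non-negative observables are non-negative. [folklore] -/
private theorem wilsonExpectation_nonneg {d L : ℕ} [NeZero L] (β : ℝ) {F : GaugeConfig d L G → ℝ}
    (hF : ∀ U, 0 ≤ F U) : 0 ≤ wilsonExpectation ρ β F :=
  integral_nonneg hF

/-- **`⟨∏ₓ P_x²⟩_β ≤ (4/(eβ))^{2L⁴} · Z(β/2)/Z(β)`** (integrate the pointwise bound
`prod_plaq_sq_le`; only the right-hand side needs to be integrable). [folklore] -/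
private theorem wilsonExpectation_prod_sq_le {L : ℕ} [NeZero L] (hρ : Continuous ρ) {β : ℝ}
    (hβ : 0 < β) :
    wilsonExpectation ρ β (fun U : GaugeConfig 4 L G =>
        ∏ x : Site 4 L, ((N : ℝ) - (ρ (plaquetteHolonomy U x 0 1)).trace.re) ^ 2) ≤
      (4 / (Real.exp 1 * β)) ^ (2 * L ^ 4) *
        ((partitionFunction (d := 4) (L := L) ρ (β / 2)).toReal /
          (partitionFunction (d := 4) (L := L) ρ β).toReal) := by
  haveI := isProbabilityMeasure_wilsonMeasure (d := 4) (L := L) ρ hρ β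
  rw [← wilsonExpectation_exp_half_mul ρ hρ β]
  unfold wilsonExpectation
  rw [← integral_const_mul]
  refine integral_mono_of_nonneg (ae_of_all _ fun U => ?_)
    ((integrable_exp_mul_wilsonAction ρ hρ (β / 2) _).const_mul _) (ae_of_all _ fun U => ?_)
  · exact Finset.prod_nonneg fun x _ => sq_nonneg _
  · exact prod_plaq_sq_le ρ (re_trace_le ρ hρ) hβ U

/-- **The variance is non-negative and at most the second moment**: for a bounded measurable
observable `X` of the Wilson theory, `|⟨X·X⟩ − ⟨X⟩⟨X⟩| ≤ ⟨X²⟩`. [folklore] -/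
private theorem abs_var_le_wilsonExpectation_sq {d L : ℕ} [NeZero L] (hρ : Continuous ρ) (β : ℝ)
    {X : GaugeConfig d L G → ℝ} (hX : Measurable X) {C : ℝ} (hC : ∀ U, |X U| ≤ C) :
    |wilsonExpectation ρ β (fun U => X U * X U) -
        wilsonExpectation ρ β X * wilsonExpectation ρ β X| ≤
      wilsonExpectation ρ β (fun U => X U ^ 2) := by
  haveI := isProbabilityMeasure_wilsonMeasure (d := d) (L := L) ρ hρ β
  unfold wilsonExpectation
  set μ := wilsonMeasure (d := d) (L := L) ρ β with hμ
  have hXm : AEStronglyMeasurable X μ := hX.aestronglyMeasurable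
  have hmem : MemLp X 2 μ :=
    MemLp.of_bound hXm C (ae_of_all _ fun U => by rw [Real.norm_eq_abs]; exact hC U)
  have h1 : variance X μ = μ[X ^ 2] - μ[X] ^ 2 := variance_eq_sub hmem
  have h2 : 0 ≤ variance X μ := variance_nonneg X μ
  have h3 : variance X μ ≤ μ[X ^ 2] := variance_le_expectation_sq hXm
  have e1 : (∫ U, X U * X U ∂μ) = μ[X ^ 2] := by
    congr 1
    funext U
    simp [sq]
  have e2 : (∫ U, X U ^ 2 ∂μ) = μ[X ^ 2] := rfl
  rw [e1, e2, ← sq, ← h1, abs_of_nonneg h2]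
  exact h3

end Wilson

end Summit.QuantumFields.YangMills.Theorems.FemtoCurvatureTwoPoint.VarianceEven

/-! ### The stub -/

namespace Summit.QuantumFields.YangMills.Theorems.FemtoCurvatureTwoPoint

open Literature.MathematicalPhysics.QuantumFieldTheory

/-- **Stub VAR-even — plaquette variance on every even torus from chessboard + `Z`-doubling**
(line `generic-step-gamma-encoding` of crux `FemtoCurvatureTwoPoint`, stmt-QuantumFields-9363;
the registered signature verbatim). From the chessboard estimate for the `01`-plaquette field on
even tori (hypothesis 1) and the partition-function doubling bound `Z_L(β/2) ≤ e^{AL⁴} Z_L(β)`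
for `β ≥ B₂(L)` (hypothesis 2): `β² · |⟨P²⟩ − ⟨P⟩²| ≤ 16 e^{A} / e²` for every even `L` and
`β ≥ max(B₂(L), 1)`, `P = N − Re tr r.ρ(U_{0;01})`. [folklore] -/
theorem stub_varianceEven_of_chessboard_doubling :
    (∀ (G : Type) [Group G] [TopologicalSpace G] [IsTopologicalGroup G] [CompactSpace G]
          [MeasurableSpace G] [BorelSpace G] (N : ℕ) (ρ : G →* Matrix (Fin N) (Fin N) ℂ),
        Continuous ρ → (∀ g, ρ g ∈ Matrix.unitaryGroup (Fin N) ℂ) →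
        ∀ (L : ℕ) [NeZero L], Even L → ∀ (β : ℝ), 0 ≤ β →
        ∀ (f : ℝ → ℝ), Measurable f → (∀ t, 0 ≤ f t) → (∃ M : ℝ, ∀ t, f t ≤ M) →
          wilsonExpectation (d := 4) (L := L) ρ β
              (fun U => f ((N : ℝ) - (ρ (plaquetteHolonomy U 0 0 1)).trace.re)) ≤
            (wilsonExpectation (d := 4) (L := L) ρ β
              (fun U => ∏ x : Fin 4 → ZMod L, f ((N : ℝ) - (ρ (plaquetteHolonomy U x 0 1)).trace.re)))
              ^ ((1 : ℝ) / (L : ℝ) ^ 4)) →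
    (∀ (G : Type) [Group G] [TopologicalSpace G] [IsTopologicalGroup G] [CompactSpace G]
          [MeasurableSpace G] [BorelSpace G] (r : LatticeRep G), ∃ A : ℝ, ∀ (L : ℕ) [NeZero L],
        ∃ B : ℝ, ∀ β : ℝ, B ≤ β →
          (partitionFunction (d := 4) (L := L) r.ρ (β / 2)).toReal ≤
            Real.exp (A * (L : ℝ) ^ 4) * (partitionFunction (d := 4) (L := L) r.ρ β).toReal) →
    ∀ (G : Type) [Group G] [TopologicalSpace G] [IsTopologicalGroup G] [CompactSpace G]
        [MeasurableSpace G] [BorelSpace G], IsCompactSimpleLieGroup G →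
      ∀ (r : LatticeRep G), ∃ (B : ℕ → ℝ) (C : ℝ),
        ∀ (L : ℕ) [NeZero L], Even L → ∀ (β : ℝ), B L ≤ β →
        ∀ (P : (Fin 4 → ZMod L) → Fin 4 → Fin 4 → GaugeConfig 4 L G → ℝ)
          (E : (GaugeConfig 4 L G → ℝ) → ℝ),
          (P = fun x i j U => (r.N : ℝ) - (r.ρ (plaquetteHolonomy U x i j)).trace.re) →
          (E = fun F => wilsonExpectation r.ρ β F) →
        β ^ 2 * |E (fun U => P 0 0 1 U * P 0 0 1 U) - E (P 0 0 1) * E (P 0 0 1)| ≤ C := by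
  intro hChess hDbl G i1 i2 i3 i4 i5 i6 _hG r
  -- thresholds `B₂ L` from the doubling bound (junk value at `L = 0`)
  obtain ⟨A, hA⟩ := hDbl G r
  have hA' : ∀ L : ℕ, ∃ B : ℝ, ∀ β : ℝ, B ≤ β → ∀ [NeZero L],
      (partitionFunction (d := 4) (L := L) r.ρ (β / 2)).toReal ≤
        Real.exp (A * (L : ℝ) ^ 4) * (partitionFunction (d := 4) (L := L) r.ρ β).toReal := by
    intro L
    by_cases hL0 : L = 0
    · refine ⟨0, fun β _ => ?_⟩
      intro _
      exact absurd hL0 (NeZero.ne L)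
    · haveI : NeZero L := ⟨hL0⟩
      obtain ⟨B, hB⟩ := hA L
      refine ⟨B, fun β hβ => ?_⟩
      intro _
      exact hB β hβ
  choose B₂ hB₂ using hA'
  refine ⟨fun L => max (B₂ L) 1, 16 * Real.exp A / Real.exp 1 ^ 2, ?_⟩
  intro L iL hL β hβ P E hP hE
  subst hP hE
  dsimp only
  have hβ1 : 1 ≤ β := le_trans (le_max_right _ _) hβ
  have hβ0 : 0 < β := lt_of_lt_of_le one_pos hβ1
  have hdbl : (partitionFunction (d := 4) (L := L) r.ρ (β / 2)).toReal ≤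
      Real.exp (A * (L : ℝ) ^ 4) * (partitionFunction (d := 4) (L := L) r.ρ β).toReal :=
    hB₂ L β (le_trans (le_max_left _ _) hβ)
  -- (i) `|Var P| ≤ ⟨P²⟩`
  have hXm := VarianceEven.measurable_plaq01 r.ρ r.continuous (0 : Site 4 L)
  have hXb : ∀ U : GaugeConfig 4 L G,
      |(r.N : ℝ) - (r.ρ (plaquetteHolonomy U 0 0 1)).trace.re| ≤ 2 * r.N := fun U => by
    obtain ⟨h0, h2⟩ := VarianceEven.plaqField_mem r.ρ r.continuous (plaquetteHolonomy U 0 0 1)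
    rw [abs_of_nonneg h0]
    exact h2
  have hvar := VarianceEven.abs_var_le_wilsonExpectation_sq r.ρ r.continuous β hXm hXb
  -- (ii) chessboard with `f = min (t², 4N²)`, `f(P_x) = P_x²`
  have hmin : ∀ (U : GaugeConfig 4 L G) (x : Site 4 L),
      min (((r.N : ℝ) - (r.ρ (plaquetteHolonomy U x 0 1)).trace.re) ^ 2) ((2 * (r.N : ℝ)) ^ 2) =
        ((r.N : ℝ) - (r.ρ (plaquetteHolonomy U x 0 1)).trace.re) ^ 2 := fun U x => by
    obtain ⟨h0, h2⟩ := VarianceEven.plaqField_mem r.ρ r.continuous (plaquetteHolonomy U x 0 1)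
    exact min_eq_left (pow_le_pow_left₀ h0 h2 2)
  have hf := hChess G r.N r.ρ r.continuous r.mem_unitary L hL β hβ0.le
    (fun t => min (t ^ 2) ((2 * (r.N : ℝ)) ^ 2))
    ((continuous_id.pow 2).min continuous_const).measurable
    (fun t => le_min (sq_nonneg t) (sq_nonneg _)) ⟨(2 * (r.N : ℝ)) ^ 2, fun t => min_le_right _ _⟩
  simp only [hmin] at hf
  -- (iii)–(v) `⟨∏ₓ P_x²⟩ ≤ M^{L⁴}` with `M = (4/(eβ))² e^{A}`
  have hprod : wilsonExpectation r.ρ β (fun U : GaugeConfig 4 L G =>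
      ∏ x : Site 4 L, ((r.N : ℝ) - (r.ρ (plaquetteHolonomy U x 0 1)).trace.re) ^ 2) ≤
        ((4 / (Real.exp 1 * β)) ^ 2 * Real.exp A) ^ (L ^ 4) := by
    refine (VarianceEven.wilsonExpectation_prod_sq_le r.ρ r.continuous hβ0).trans ?_
    have hZ := VarianceEven.partitionFunction_toReal_pos (d := 4) (L := L) r.ρ r.continuous β
    have hratio : (partitionFunction (d := 4) (L := L) r.ρ (β / 2)).toReal /
        (partitionFunction (d := 4) (L := L) r.ρ β).toReal ≤ Real.exp (A * (L : ℝ) ^ 4) := by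
      rw [div_le_iff₀ hZ]
      exact hdbl
    calc (4 / (Real.exp 1 * β)) ^ (2 * L ^ 4) *
          ((partitionFunction (d := 4) (L := L) r.ρ (β / 2)).toReal /
            (partitionFunction (d := 4) (L := L) r.ρ β).toReal)
        ≤ (4 / (Real.exp 1 * β)) ^ (2 * L ^ 4) * Real.exp (A * (L : ℝ) ^ 4) :=
          mul_le_mul_of_nonneg_left hratio (pow_nonneg (by positivity) _)
      _ = ((4 / (Real.exp 1 * β)) ^ 2 * Real.exp A) ^ (L ^ 4) := by
          rw [pow_mul, mul_pow, ← Real.exp_nat_mul]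
          congr 2
          push_cast
          ring
  -- (vi) the `L⁴`-th root
  have hroot : (wilsonExpectation r.ρ β (fun U : GaugeConfig 4 L G =>
      ∏ x : Site 4 L, ((r.N : ℝ) - (r.ρ (plaquetteHolonomy U x 0 1)).trace.re) ^ 2)) ^
        ((1 : ℝ) / (L : ℝ) ^ 4) ≤ (4 / (Real.exp 1 * β)) ^ 2 * Real.exp A := by
    have h0 : 0 ≤ wilsonExpectation r.ρ β (fun U : GaugeConfig 4 L G =>
        ∏ x : Site 4 L, ((r.N : ℝ) - (r.ρ (plaquetteHolonomy U x 0 1)).trace.re) ^ 2) :=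
      VarianceEven.wilsonExpectation_nonneg r.ρ β fun U =>
        Finset.prod_nonneg fun x _ => sq_nonneg _
    have hM0 : 0 ≤ (4 / (Real.exp 1 * β)) ^ 2 * Real.exp A := by positivity
    have hk0 : L ^ 4 ≠ 0 := pow_ne_zero 4 (NeZero.ne L)
    calc _ ≤ (((4 / (Real.exp 1 * β)) ^ 2 * Real.exp A) ^ (L ^ 4)) ^ ((1 : ℝ) / (L : ℝ) ^ 4) :=
          Real.rpow_le_rpow h0 hprod (by positivity)
      _ = (4 / (Real.exp 1 * β)) ^ 2 * Real.exp A := by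
          rw [one_div, ← Nat.cast_pow]
          exact Real.pow_rpow_inv_natCast hM0 hk0
  have hβne : β ≠ 0 := hβ0.ne'
  calc _ ≤ β ^ 2 * ((4 / (Real.exp 1 * β)) ^ 2 * Real.exp A) :=
        mul_le_mul_of_nonneg_left (hvar.trans (hf.trans hroot)) (sq_nonneg β)
    _ = 16 * Real.exp A / Real.exp 1 ^ 2 := by
        field_simp
        ring

end Summit.QuantumFields.YangMills.Theorems.FemtoCurvatureTwoPoint

end
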